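import Summits.BirchSwinnertonDyer.BirchSwinnertonDyer.Theorems.KolyvaginRoadThreeZhangSupplyJump
import Summits.BirchSwinnertonDyer.BirchSwinnertonDyer.Theorems.KolyvaginRoadThreeZhangSupplyWeil
import Summits.BirchSwinnertonDyer.Rank1Residual.X11b.KummerStructureDuality
import HarnessLib

/-!
# Route `KolyvaginRoadThree`, deciding crux `ZhangSharpFrameAtThreeHL` (item stmt-BirchSwinnertonDyer-19574):
# (J) — the numeric self-duality of part XI from the WEIL TRANSPORT and LAGRANGIAN local conditions; the unsigned
# jump at a relaxed place for `E[n]` modulo the Lagrangian property alone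
# (cell `bsd-stepL`, ACCEL seat `bsd-stepL-koly3b` g5; `--supports stmt-BirchSwinnertonDyer-19574`, helper; part XII of
# the `KolyvaginRoadThreeZhangSupply*` series)

HONEST FRAMING. Theorems only; 0 definitions, 0 named facts, 0 `sorry`; CONDITIONAL on the Poitou–Tate properties of the
family `inv` (`poitouTate_selmerStructure_duality`), on a Weil pairing `e` on `E[n]` (tree fact `exists_weilPairing`,
proved) and on the LAGRANGIAN property of the local conditions; nothing at `p = 3` is asserted; closes nothing (T7).
PARTITION: O2@3 (B10) × A1 × crux 19574 × the S2-ENGINE's (Supply) binder — proves-glue.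

WHAT. Part XI (`exists_forall_sub_zsmul_not_mem_ker_localization`) took the numeric self-duality
`#H¹_{𝓕*}(K, E[n]^D) = #H¹_𝓖(K, E[n])`, `#H¹_{𝓖*}(K, E[n]^D) = #H¹_𝓕(K, E[n])` of the strict ∕ relaxed pair at `w` as
hypotheses. Here:
* §1 `card_dualSelmerGroup_eq_of_weilTransport` — for Selmer structures `𝓐`, `𝓒` on `E[n]` such that at EVERY place the
  inverse Weil transport `H¹(w_v⁻¹)` maps `𝓐_v^*` into `𝓒_v` and `H¹(w_v)` maps `𝓒_v` into `𝓐_v^*`, the transports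
  `H¹(w⁻¹)`, `H¹(w)` are inverse bijections `H¹_{𝓐*}(K, E[n]^D) ≃ H¹_𝓒(K, E[n])`, so the orders agree (X11b's
  `KummerDuality.map_weilDualInv_mem_selmerGroup_of_mem_dualSelmerGroup`, generalised from the Kummer structure to any
  pair of conditions in duality);
* §2 the two local hypotheses from a LAGRANGIAN condition `D = D^{⊥}` for `inv_v(· ∪ₑ ·)` (`X11b.invWeilPairing`; for the
  Kummer condition this is X11b's `annRight_invWeilPairing_kummerSelmerStructure_eq`), and at the exceptional place from
  `0^* = H¹`, `(H¹)^* = 0` (perfectness);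
* §3 `exists_forall_sub_zsmul_not_mem_ker_localization_of_lagrangian` — (J) for `E[n]`: if the common conditions of the
  strict ∕ relaxed pair at the finite place `w` are Lagrangian at every place `≠ w`, the strict Selmer group is finite and
  `n² < #H¹(K_w, E[n])`, then the image of the `w`-relaxed Selmer group at `w` is not inside a line.
So the binder `hjump` of part IX-b now costs exactly: the PT fact, a Weil pairing, `#H¹(K_λ, E[3]) = 81 > 9`, finiteness,
and the Lagrangian property of E's Kummer condition (X11b, modulo the local Euler characteristic), of the ORDINARY condition
above good unipotent-admissible primes and of the TRANSVERSE condition at Kolyvagin primes (zhang3-p1's D2 ∕ D3) — plus the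
dictionary of those genuine conditions with the global kernels.

References: [cite: McCallumLMS1991, Prop. 2.1 (p. 296)] [cite: WZhang2014, Lemma 8.2] [cite: MilneADT2006, Ch. I, Cor. 2.3,
Cor. 3.4, Thm. 4.10, §6 proof of Prop. 6.9] [cite: Howard2004HeegnerKolyvagin, Def. 2.1.6, Thm. 2.1.11]
[cite: JetchevSkinnerWan2017, Prop. 3.2.1 (proof)].
-/

noncomputable section

open scoped Classical NumberField
open Function NumberField IsDedekindDomain
open Literature.NumberTheory.EllipticCurves
open Literature.NumberTheory.GaloisRepresentations Literature.NumberTheory.GaloisRepresentations.DiscreteGaloisModule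
  Literature.NumberTheory.GaloisCohomology
open Summit.BirchSwinnertonDyer.Rank1Residual.X11b.FiniteDuality
open Summit.BirchSwinnertonDyer.Rank1Residual.GaloisImage
open Summit.BirchSwinnertonDyer.Rank1Residual.X11b.LocBridge
open Summit.BirchSwinnertonDyer.Rank1Residual.X11b.Relaxation

universe u

namespace Summit.BirchSwinnertonDyer.Rank1Residual.X11b.Three.Koly.ZhangSupply

variable {K : Type u} [Field K] [NumberField K] (W : WeierstrassCurve K) (n : ℕ) [NeZero n] [W.IsElliptic]
variable (e : W.geomTorsion n → W.geomTorsion n → AlgebraicClosure K)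
  (hμ : ∀ S T, e S T ^ n = 1)
  (hadd₁ : ∀ S₁ S₂ T, e (S₁ + S₂) T = e S₁ T * e S₂ T)
  (hadd₂ : ∀ S T₁ T₂, e S (T₁ + T₂) = e S T₁ * e S T₂)
  (hgal : ∀ (σ : Field.absoluteGaloisGroup K) (S T : W.geomTorsion n), σ • e S T = e (σ • S) (σ • T))
  (hnondeg : ∀ T, (∀ S, e S T = 1) → T = 0)
  (inv : LocalInvariants K n)

/-! ## §1 Selmer groups in Weil duality have the same order -/

/-- **The Weil transport commutes with localisation**: `loc_v (H¹(w) x) = H¹(w_v) (loc_v x)`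
(`galoisCohomology.res_map_one`; companion of part III's `localization_map_weilDualInv`). [folklore] -/
theorem localization_map_weilDual [Finite (W.geomTorsion n)] (v : Place K)
    (x : galoisCohomology (W.torsionGaloisModule n) 1) :
    galoisCohomology.localization ((W.torsionGaloisModule n).tateDual n) v 1
        (galoisCohomology.map (weilDualIntertwining W n e hμ hadd₁ hadd₂ hgal) 1 x) =
      galoisCohomology.map ((weilDualIntertwining W n e hμ hadd₁ hadd₂ hgal).restrictField (Place.Completion v)) 1
        (galoisCohomology.localization (W.torsionGaloisModule n) v 1 x) :=
  galoisCohomology.res_map_one (Place.Completion v) (weilDualIntertwining W n e hμ hadd₁ hadd₂ hgal) x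

/-- **`#H¹_{𝓐*}(K, E[n]^D) = #H¹_𝓒(K, E[n])` when the Weil transport exchanges the conditions.** If at every place
`H¹(w_v⁻¹)` maps the dual condition `𝓐_v^*` into `𝓒_v` and `H¹(w_v)` maps `𝓒_v` into `𝓐_v^*`, then `H¹(w⁻¹)` and `H¹(w)`
are inverse bijections between `H¹_{𝓐*}(K, E[n]^D)` and `H¹_𝓒(K, E[n])` (they commute with localisation and are inverse
to each other on `H¹`). [cite: MilneADT2006, Ch. I §6, proof of Prop. 6.9] [cite: JetchevSkinnerWan2017, Prop. 3.2.1 (proof)] -/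
theorem card_dualSelmerGroup_eq_of_weilTransport [Finite (W.geomTorsion n)]
    (𝓐 𝓒 : SelmerStructure (W.torsionGaloisModule n))
    (h1 : ∀ (v : Place K), ∀ b ∈ inv.dualLocalCondition (W.torsionGaloisModule n) v (𝓐 v),
      galoisCohomology.map ((weilDualInv W n e hμ hadd₁ hadd₂ hgal hnondeg).restrictField (Place.Completion v)) 1 b ∈
        𝓒 v)
    (h2 : ∀ (v : Place K), ∀ a ∈ 𝓒 v,
      galoisCohomology.map ((weilDualIntertwining W n e hμ hadd₁ hadd₂ hgal).restrictField (Place.Completion v)) 1 a ∈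
        inv.dualLocalCondition (W.torsionGaloisModule n) v (𝓐 v)) :
    Nat.card (inv.dualSelmerStructure (W.torsionGaloisModule n) 𝓐).selmerGroup = Nat.card 𝓒.selmerGroup := by
  -- the two transports preserve the Selmer groups
  have hto : ∀ y ∈ (inv.dualSelmerStructure (W.torsionGaloisModule n) 𝓐).selmerGroup,
      galoisCohomology.map (weilDualInv W n e hμ hadd₁ hadd₂ hgal hnondeg) 1 y ∈ 𝓒.selmerGroup := by
    intro y hy
    rw [SelmerStructure.mem_selmerGroup_iff] at hy ⊢
    intro v
    rw [localization_map_weilDualInv]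
    exact h1 v _ (by have := hy v; rwa [LocalInvariants.dualSelmerStructure_apply] at this)
  have hfro : ∀ x ∈ 𝓒.selmerGroup, galoisCohomology.map (weilDualIntertwining W n e hμ hadd₁ hadd₂ hgal) 1 x ∈
      (inv.dualSelmerStructure (W.torsionGaloisModule n) 𝓐).selmerGroup := by
    intro x hx
    rw [SelmerStructure.mem_selmerGroup_iff] at hx ⊢
    intro v
    rw [LocalInvariants.dualSelmerStructure_apply, localization_map_weilDual]
    exact h2 v _ (hx v)
  refine Nat.card_congr
    { toFun := fun y ↦ ⟨_, hto y.1 y.2⟩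
      invFun := fun x ↦ ⟨_, hfro x.1 x.2⟩
      left_inv := fun y ↦ Subtype.ext (map_weilDual_map_weilDualInv W n e hμ hadd₁ hadd₂ hgal hnondeg y.1)
      right_inv := fun x ↦ Subtype.ext (map_weilDualInv_map_weilDual W n e hμ hadd₁ hadd₂ hgal hnondeg x.1) }

/-! ## §2 The local hypotheses: Lagrangian conditions, and the exceptional place -/

/-- **A Lagrangian condition pulls its dual back to itself**: if `D ≤ H¹(K_v, E[n])` is its own right annihilator under
`inv_v(· ∪ₑ ·)`, then `H¹(w_v⁻¹)` maps `D^*` into `D` (X11b `KummerDuality.map_weilDualInv_mem_kummerSelmerStructure_of_mem_dual`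
for a general condition). [cite: Howard2004HeegnerKolyvagin, Def. 2.1.6] [cite: MilneADT2006, Ch. I, Cor. 3.4] -/
theorem map_weilDualInv_mem_of_mem_dual_of_lagrangian [Finite (W.geomTorsion n)] (v : Place K)
    (D : AddSubgroup (galoisCohomology ((W.torsionGaloisModule n).toLocal v) 1))
    (hmax : annRight (invWeilPairing W n e hμ hadd₁ hadd₂ hgal inv v) D = D)
    {b : galoisCohomology (((W.torsionGaloisModule n).tateDual n).toLocal v) 1}
    (hb : b ∈ inv.dualLocalCondition (W.torsionGaloisModule n) v D) :
    galoisCohomology.map ((weilDualInv W n e hμ hadd₁ hadd₂ hgal hnondeg).restrictField (Place.Completion v)) 1 b ∈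
      D := by
  set y := galoisCohomology.map ((weilDualInv W n e hμ hadd₁ hadd₂ hgal hnondeg).restrictField
    (Place.Completion v)) 1 b with hy
  rw [← hmax]
  refine (mem_annRight_iff _ _ _).mpr fun a ha ↦ ?_
  rw [LocalInvariants.mem_dualLocalCondition_iff] at hb
  have key : localTatePairingZMod (W.torsionGaloisModule n) n v (inv v) a
      (galoisCohomology.map ((weilDualIntertwining W n e hμ hadd₁ hadd₂ hgal).restrictField
        (Place.Completion v)) 1 y) = 0 := by
    rw [hy, map_weilDual_map_weilDualInv_restrictField]
    exact hb a ha
  rw [localTatePairingZMod_map_weilDual] at key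
  exact key

/-- **A Lagrangian (indeed any isotropic) condition is carried into its dual**: if `D` is its own right annihilator under
`inv_v(· ∪ₑ ·)`, then `H¹(w_v)` maps `D` into `D^*` (`⟨a′, H¹(w_v) a⟩_v = inv_v(a′ ∪ₑ a) = 0` for `a′, a ∈ D`).
[cite: MilneADT2006, Ch. I §6, proof of Prop. 6.9] -/
theorem map_weilDual_mem_dual_of_lagrangian [Finite (W.geomTorsion n)] (v : Place K)
    (D : AddSubgroup (galoisCohomology ((W.torsionGaloisModule n).toLocal v) 1))
    (hmax : annRight (invWeilPairing W n e hμ hadd₁ hadd₂ hgal inv v) D = D)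
    {a : galoisCohomology ((W.torsionGaloisModule n).toLocal v) 1} (ha : a ∈ D) :
    galoisCohomology.map ((weilDualIntertwining W n e hμ hadd₁ hadd₂ hgal).restrictField (Place.Completion v)) 1 a ∈
      inv.dualLocalCondition (W.torsionGaloisModule n) v D := by
  change ∀ a' ∈ D, localTatePairingZMod (W.torsionGaloisModule n) n v (inv v) a'
    (galoisCohomology.map ((weilDualIntertwining W n e hμ hadd₁ hadd₂ hgal).restrictField (Place.Completion v)) 1 a) = 0
  intro a' ha'
  have key := localTatePairingZMod_map_weilDual W n e hμ hadd₁ hadd₂ hgal v (inv v) a' a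
  rw [key]
  have h : a ∈ annRight (invWeilPairing W n e hμ hadd₁ hadd₂ hgal inv v) D := by rw [hmax]; exact ha
  exact (mem_annRight_iff _ _ _).mp h a' ha'

omit [NeZero n] [W.IsElliptic] in
/-- **`0^* = H¹`**: the dual of the strict condition is the relaxed condition (every class annihilates `0`).
[cite: Howard2004HeegnerKolyvagin, Def. 2.1.6] -/
theorem dualLocalCondition_bot_eq_top [Finite (W.geomTorsion n)] (v : Place K) :
    inv.dualLocalCondition (W.torsionGaloisModule n) v ⊥ = ⊤ := by
  rw [eq_top_iff]
  intro b _
  rw [LocalInvariants.mem_dualLocalCondition_iff]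
  intro a ha
  rw [(AddSubgroup.mem_bot).mp ha, map_zero, AddMonoidHom.zero_apply]

/-! ## §3 (J) for `E[n]` modulo the Lagrangian property -/

include hnondeg in
/-- **(J) — the unsigned jump for `E[n]` from LAGRANGIAN local conditions.** `𝓕 ≤ 𝓖` Selmer structures on `E[n]`
unramified outside `S(T)`, equal off the finite place `w ∈ T`, `𝓕_w = 0`, `𝓖_w = H¹(K_w, E[n])`; the common condition at
every place `v ≠ w` is LAGRANGIAN for `inv_v(· ∪ₑ ·)` (`hmax`); `inv` a Poitou–Tate family, `e` a Weil pairing; `H¹_𝓕`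
finite; `n² < #H¹(K_w, E[n])`. Then for every `x₀ ∈ H¹(K, E[n])` some `x ∈ H¹_𝓖(K, E[n])` has `x − a • x₀ ∉ ker loc_w`
for all `a : ℤ`: by §1–§2 `#H¹_{𝓕*} = #H¹_𝓖` and `#H¹_{𝓖*} = #H¹_𝓕` (at `w`: `0^* = H¹`, `(H¹)^* = 0` by
perfectness), and part XI. For the KOLY level structures at `p = 3` and a Kolyvagin `λ` (`#H¹(K_λ, E[3]) = 81`) this is the
binder `hjump` up to the dictionary genuine conditions ↔ global kernels.
[cite: McCallumLMS1991, Prop. 2.1 (p. 296)] [cite: WZhang2014, Lemma 8.2] [cite: MilneADT2006, Ch. I, Thm. 4.10] -/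
theorem exists_forall_sub_zsmul_not_mem_ker_localization_of_lagrangian [Finite (W.geomTorsion n)]
    (hperf : inv.IsPerfect) (hsum : inv.SumLocalTermEqZero) (hcompl : inv.SelmerComplement)
    (T : Finset (HeightOneSpectrum (𝓞 K)))
    (hS : ∀ v : HeightOneSpectrum (𝓞 K), v ∉ T → ((n : ℕ) : 𝓞 K) ∉ v.asIdeal ∧
      GaloisRep.IsUnramifiedAt v (W.torsionGaloisModule n))
    {𝓕 𝓖 : SelmerStructure (W.torsionGaloisModule n)} (h𝓕 : 𝓕.IsUnramifiedOutside (finSupport T))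
    (h𝓖 : 𝓖.IsUnramifiedOutside (finSupport T)) (w : T)
    (heq : ∀ v : Place K, v ≠ Sum.inr w.1 → 𝓕 v = 𝓖 v)
    (hstrict : 𝓕 (Sum.inr w.1) = ⊥) (hrelax : 𝓖 (Sum.inr w.1) = ⊤) (hfin : Finite 𝓕.selmerGroup)
    (hmax : ∀ v : Place K, v ≠ Sum.inr w.1 →
      annRight (invWeilPairing W n e hμ hadd₁ hadd₂ hgal inv v) (𝓕 v) = 𝓕 v)
    (hw : n ^ 2 < Nat.card (galoisCohomology ((W.torsionGaloisModule n).toLocal (Sum.inr w.1)) 1))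
    (x₀ : galoisCohomology (W.torsionGaloisModule n) 1) :
    ∃ x ∈ 𝓖.selmerGroup, ∀ a : ℤ,
      x - a • x₀ ∉ (galoisCohomology.localization (W.torsionGaloisModule n) (Sum.inr w.1) 1).ker := by
  have hM : ∀ m : W.geomTorsion n, n • m = 0 := fun m ↦ AddSubgroup.torsionBy.nsmul m
  -- `#H¹_{𝓕*} = #H¹_𝓖`
  have hFd : Nat.card (inv.dualSelmerStructure (W.torsionGaloisModule n) 𝓕).selmerGroup =
      Nat.card 𝓖.selmerGroup := by
    refine card_dualSelmerGroup_eq_of_weilTransport W n e hμ hadd₁ hadd₂ hgal hnondeg inv 𝓕 𝓖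
      (fun v b hb ↦ ?_) (fun v a ha ↦ ?_)
    · by_cases hv : v = Sum.inr w.1
      · subst hv; rw [hrelax]; exact AddSubgroup.mem_top _
      · rw [← heq v hv]
        exact map_weilDualInv_mem_of_mem_dual_of_lagrangian W n e hμ hadd₁ hadd₂ hgal hnondeg inv v _ (hmax v hv) hb
    · by_cases hv : v = Sum.inr w.1
      · subst hv
        rw [hstrict, dualLocalCondition_bot_eq_top]
        exact AddSubgroup.mem_top _
      · rw [← heq v hv] at ha
        exact map_weilDual_mem_dual_of_lagrangian W n e hμ hadd₁ hadd₂ hgal inv v _ (hmax v hv) ha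
  -- `#H¹_{𝓖*} = #H¹_𝓕`
  have hGd : Nat.card (inv.dualSelmerStructure (W.torsionGaloisModule n) 𝓖).selmerGroup =
      Nat.card 𝓕.selmerGroup := by
    refine card_dualSelmerGroup_eq_of_weilTransport W n e hμ hadd₁ hadd₂ hgal hnondeg inv 𝓖 𝓕
      (fun v b hb ↦ ?_) (fun v a ha ↦ ?_)
    · by_cases hv : v = Sum.inr w.1
      · subst hv
        rw [hrelax, dualLocalCondition_top_eq_bot (W.torsionGaloisModule n) inv hperf hM w.1] at hb
        have hb0 : b = 0 := (AddSubgroup.mem_bot).mp hb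
        subst hb0
        exact (map_zero (galoisCohomology.map ((weilDualInv W n e hμ hadd₁ hadd₂ hgal hnondeg).restrictField
          (Place.Completion (Sum.inr w.1 : Place K))) 1)).symm ▸ AddSubgroup.zero_mem _
      · rw [← heq v hv] at hb
        exact map_weilDualInv_mem_of_mem_dual_of_lagrangian W n e hμ hadd₁ hadd₂ hgal hnondeg inv v _ (hmax v hv) hb
    · by_cases hv : v = Sum.inr w.1
      · subst hv
        rw [hstrict] at ha
        have ha0 : a = 0 := (AddSubgroup.mem_bot).mp ha
        subst ha0
        exact (map_zero (galoisCohomology.map ((weilDualIntertwining W n e hμ hadd₁ hadd₂ hgal).restrictField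
          (Place.Completion (Sum.inr w.1 : Place K))) 1)).symm ▸ AddSubgroup.zero_mem _
      · rw [← heq v hv]
        exact map_weilDual_mem_dual_of_lagrangian W n e hμ hadd₁ hadd₂ hgal inv v _ (hmax v hv) ha
  exact exists_forall_sub_zsmul_not_mem_ker_localization T inv hperf hsum hcompl hM hS h𝓕 h𝓖 w heq hstrict hrelax
    hfin hFd hGd hw x₀

end Summit.BirchSwinnertonDyer.Rank1Residual.X11b.Three.Koly.ZhangSupply

end
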